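import Summits.ABC.ABC.Theorems.IneffectiveSubspaceUniformSadicTowerFourStubOmegaCountedTwo

/-!
# `UniformSadicTowerFour` (stmt-ABC-14937), line `flat-steep-split` (lead c3): the even-exponent
# part of shape A of the rung `W = 3` is the finite list `{16, 25, 49, 64, 81, 289}`

Modulo the route's crux #6 the crux `UniformSadicTowerFour` is BoundedOmegaABC; its first open
rung `W = 3` is abc on three exponential shapes, shape A being `r^z = 1 + p^x q^y` with three
primes `p ≠ q`, `r` and `x, y ≥ 1`.  This file CLOSES the even-exponent part `z = 2w` of shape A:

**Theorem** (`shapeA_even_classification`). If `p, q, r` are primes, `p ≠ q`, `x, y ≥ 1` and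
`1 + p^x q^y = r^(2w)`, then `r^(2w) ∈ {16, 25, 49, 64, 81, 289}`
(`15 = 3·5`, `24 = 2³·3`, `48 = 2⁴·3`, `63 = 3²·7`, `80 = 2⁴·5`, `288 = 2⁵·3²`).

**Proof.** Put `m = r^w = A + 1`, so `A (A + 2) = p^x q^y` with `A ≥ 1`.
* `r = 2`.  Then `3 ∣ 4^w - 1`, so `3 ∈ {p, q}`, say `p = 3`, and `A, A + 2` are odd, so the prime
  `q ∉ {2, 3}` divides exactly one of them.  If `q ∤ A + 2` then `q^y ∣ A`, the cofactor and `A + 2`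
  are powers of `3`, and `2^w + 1 = A + 2 = 3^j` forces (parity-Catalan (B)) `j ≤ 1` — impossible,
  `A = 1` would give `q^y = 1` — or `j = 2`: `2^w = 8`, `c = 64`.  If `q ∤ A` then `q^y ∣ A + 2` and
  `A = 3^i` with `3^i + 1 = 2^w`, so (parity-Catalan (A)) `i ≤ 1`: `i = 0` gives `A + 2 = 3`,
  `q = 3`, excluded; `i = 1` gives `2^w = 4`, `c = 16`.
* `r` odd.  Then `2 ∣ r^(2w) - 1`, so `2 ∈ {p, q}`, say `p = 2`, `q` odd; `A` is even, and
  `3 ∣ A (A + 1) (A + 2)` gives `q = 3` or `r = 3`.  The odd prime `q` divides exactly one of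
  `A, A + 2`, so one of them is a pure power of two `2^s` (`s ≥ 2` since `A ≥ 2`, the case `A = 2`,
  `A + 2 = 4 = 2^t q^y` being impossible) and the other is `2^t q^y` with `t = 1` (it is even, and
  not divisible by `4` since its neighbour at distance `2` is).
  (α) `A + 2 = 2^s`, `A = 2 q^y`: `r^w + 1 = 2^s` forces `w = 1` (A), then `q^y + 1 = 2^(s-1)`
  forces `y = 1` (A); `r = 3` would give `q = 1`, so `q = 3`, `r = 7`, `c = 49`.
  (β) `A = 2^s`, `A + 2 = 2 q^y`: `2^s + 1 = r^w` forces (B) `(r, w) = (3, 2)` — `c = 81` — or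
  `w = 1`; then `2^(s-1) + 1 = q^y` forces (B) `(q, y) = (3, 2)` — `A = 16`, `r = 17`, `c = 289` —
  or `y = 1`; then `r = 3` would give `A = 2 < 4`, so `q = 3`, `A = 4`, `r = 5`, `c = 25`.

Sources: the crux notes of the line (`Cruxes/UniformSadicTowerFour/`, census
`Census-omega3-c2.md`); the classification is elementary [folklore], resting on the two
parity-Catalan facts `MixedRadical.omegaTwo_pow_add_one_eq_two_pow` (A) and
`MixedRadical.omegaTwo_two_pow_add_one_eq_pow` (B) (Gersonides 1343).  Mathlib only
(`Nat.Coprime.dvd_of_dvd_mul_right`, `Nat.dvd_prime_pow`, `Nat.pow_right_injective`,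
`Nat.prime_dvd_prime_iff_eq`).  No new definitions.  Deliberately NOT here: the odd-exponent part
of shape A and the shapes B, C (OPEN), the other stubs of the line.
-/

-- `Summit.<Summit>.<Problem>` is the mandated summit-side namespace (CONVENTIONS §2); for the
-- single-conjunct summit `ABC` the two coincide, so the duplicate `ABC.ABC` is deliberate.
set_option linter.dupNamespace false

namespace Summit.ABC.ABC.Theorems.UniformSadicTowerFour.BoundedOmega

open Summit.ABC.ABC.Theorems.UniformSadicTowerFour.MixedRadical (omegaTwo_pow_add_one_eq_two_pow
  omegaTwo_two_pow_add_one_eq_pow)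

/-! ## Splitting a product `A · B = P · q^y` along a prime `q ∤ B` -/

/-- If the prime `q` does not divide `B` and `A · B = P · q^y`, then `q^y ∣ A` and the cofactor
`k = A / q^y` satisfies `k · B = P`. [folklore] -/
private theorem shapeA_even_split {q y A B P : ℕ} (hq : q.Prime) (hB : ¬q ∣ B)
    (h : A * B = P * q ^ y) : ∃ k, A = q ^ y * k ∧ k * B = P := by
  have hcop : Nat.Coprime (q ^ y) B :=
    Nat.Coprime.pow_left y ((Nat.Prime.coprime_iff_not_dvd hq).2 hB)
  obtain ⟨k, rfl⟩ : q ^ y ∣ A := hcop.dvd_of_dvd_mul_right ⟨P, by rw [h, mul_comm]⟩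
  refine ⟨k, rfl, Nat.eq_of_mul_eq_mul_left (pow_pos hq.pos y) ?_⟩
  rw [← mul_assoc, h, mul_comm]

/-! ## The case `r = 2` (normalised to `p = 3`) -/

/-- **Shape A, even exponent, `r = 2`.** If `q ≠ 3` is prime, `y ≥ 1` and
`1 + 3^x q^y = 2^(2w)`, then `2^(2w) ∈ {16, 64}` (`⊆ {16, 25, 49, 64, 81, 289}`). [folklore] -/
private theorem shapeA_even_of_three {q x y w : ℕ} (hq : q.Prime) (hq3 : q ≠ 3) (hy : 1 ≤ y)
    (h : 1 + 3 ^ x * q ^ y = 2 ^ (2 * w)) :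
    2 ^ (2 * w) ∈ ({16, 25, 49, 64, 81, 289} : Finset ℕ) := by
  have hw : w ≠ 0 := by
    rintro rfl
    have : 0 < 3 ^ x * q ^ y := mul_pos (pow_pos (by norm_num) x) (pow_pos hq.pos y)
    rw [mul_zero, pow_zero] at h
    omega
  obtain ⟨A, hA⟩ : ∃ A, 2 ^ w = A + 1 := ⟨2 ^ w - 1, by have := Nat.two_pow_pos w; omega⟩
  have hprod : A * (A + 2) = 3 ^ x * q ^ y := by
    have hsq : 2 ^ (2 * w) = (A + 1) ^ 2 := by rw [mul_comm 2 w, pow_mul, hA]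
    have e : (A + 1) ^ 2 = A * (A + 2) + 1 := by ring
    rw [hsq, e] at h
    omega
  -- `A` is odd (`A + 1 = 2^w`, `w ≥ 1`)
  have hAo : A % 2 = 1 := by
    obtain ⟨v, rfl⟩ : ∃ v, w = v + 1 := ⟨w - 1, by omega⟩
    have : 2 ^ (v + 1) = 2 * 2 ^ v := by ring
    omega
  have hq2 : q ≠ 2 := by
    rintro rfl
    have h2 : 2 ∣ A * (A + 2) := by
      rw [hprod]
      exact (dvd_pow_self 2 (by omega : y ≠ 0)).mul_left _
    rcases (Nat.Prime.dvd_mul Nat.prime_two).1 h2 with h2 | h2 <;> omega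
  -- the prime `q` divides at most one of `A`, `A + 2`
  have hnot : ¬(q ∣ A ∧ q ∣ A + 2) := fun ⟨h1, h2⟩ =>
    hq2 ((Nat.prime_dvd_prime_iff_eq hq Nat.prime_two).1 ((Nat.dvd_add_right h1).1 h2))
  by_cases hqA2 : q ∣ A + 2
  · -- `q ∤ A`: `A + 2 = q^y k`, `k A = 3^x`, so `A = 3^i` with `3^i + 1 = 2^w`
    obtain ⟨k, hk, hk'⟩ :=
      shapeA_even_split hq (fun h' => hnot ⟨h', hqA2⟩) ((mul_comm _ _).trans hprod)
    obtain ⟨i, -, hi⟩ := (Nat.dvd_prime_pow Nat.prime_three).1 (Dvd.intro_left _ hk')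
    have hi1 : i ≤ 1 :=
      omegaTwo_pow_add_one_eq_two_pow (by decide) le_rfl (show 3 ^ i + 1 = 2 ^ w by omega)
    interval_cases i
    · -- `A = 1`: `A + 2 = 3 = q^y k`, so `q = 3`, excluded
      rw [pow_zero] at hi
      refine absurd ((Nat.prime_dvd_prime_iff_eq hq Nat.prime_three).1 ?_) hq3
      have hdvd : q ^ y ∣ A + 2 := Dvd.intro _ hk.symm
      rw [hi] at hdvd
      exact (dvd_pow_self q (by omega : y ≠ 0)).trans hdvd
    · -- `A = 3`: `2^w = 4`, `w = 2`, `c = 16`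
      rw [pow_one] at hi
      have hw2 : w = 2 := Nat.pow_right_injective le_rfl (show 2 ^ w = 2 ^ 2 by omega)
      subst hw2
      decide
  · -- `q^y ∣ A`: `A = q^y k`, `k (A + 2) = 3^x`, so `A + 2 = 3^j = 2^w + 1`
    obtain ⟨k, hk, hk'⟩ := shapeA_even_split hq hqA2 hprod
    obtain ⟨j, -, hj⟩ := (Nat.dvd_prime_pow Nat.prime_three).1 (Dvd.intro_left _ hk')
    rcases omegaTwo_two_pow_add_one_eq_pow (by decide) le_rfl (show 2 ^ w + 1 = 3 ^ j by omega)
      with hj1 | ⟨-, rfl⟩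
    · exfalso
      interval_cases j
      · -- `A + 2 = 1`
        omega
      · -- `A + 2 = 3`: `A = 1 = q^y k`, so `q^y = 1`
        rw [pow_one] at hj
        have hA1 : A = 1 := by omega
        rw [hA1] at hk
        have h1 : q ^ y = 1 := Nat.eq_one_of_mul_eq_one_right hk.symm
        have := Nat.one_lt_pow (by omega : y ≠ 0) hq.one_lt
        omega
    · -- `A + 2 = 9`: `2^w = 8`, `w = 3`, `c = 64`
      have h8 : 2 ^ w = 8 := by norm_num at hj; omega
      have hw3 : w = 3 := Nat.pow_right_injective le_rfl (h8.trans (by norm_num))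
      subst hw3
      decide

/-! ## The case `r` odd (normalised to `p = 2`) -/

/-- **Shape A, even exponent, `r` odd.** If `q ≠ 2` and `r` are primes, `r` odd, `y ≥ 1` and
`1 + 2^x q^y = r^(2w)`, then `r^(2w) ∈ {25, 49, 81, 289}` (`⊆ {16, 25, 49, 64, 81, 289}`).
[folklore] -/
private theorem shapeA_even_of_two {q r x y w : ℕ} (hq : q.Prime) (hr : r.Prime) (hq2 : q ≠ 2)
    (hro : Odd r) (hy : 1 ≤ y) (h : 1 + 2 ^ x * q ^ y = r ^ (2 * w)) :
    r ^ (2 * w) ∈ ({16, 25, 49, 64, 81, 289} : Finset ℕ) := by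
  have hqo : Odd q := hq.odd_of_ne_two hq2
  have hq3 : 3 ≤ q := by have := hq.two_le; omega
  have hr3 : 3 ≤ r := by
    have := hr.two_le
    obtain ⟨k, hk⟩ := hro
    omega
  have hw : w ≠ 0 := by
    rintro rfl
    have : 0 < 2 ^ x * q ^ y := mul_pos (pow_pos (by norm_num) x) (pow_pos hq.pos y)
    rw [mul_zero, pow_zero] at h
    omega
  obtain ⟨A, hA⟩ : ∃ A, r ^ w = A + 1 := ⟨r ^ w - 1, by have := pow_pos hr.pos w; omega⟩
  have hprod : A * (A + 2) = 2 ^ x * q ^ y := by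
    have hsq : r ^ (2 * w) = (A + 1) ^ 2 := by rw [mul_comm 2 w, pow_mul, hA]
    have e : (A + 1) ^ 2 = A * (A + 2) + 1 := by ring
    rw [hsq, e] at h
    omega
  -- `A ≥ 2` is even
  have hA2 : 2 ≤ A := by have := Nat.le_self_pow hw r; omega
  have hAe : A % 2 = 0 := by
    obtain ⟨a, ha⟩ : Odd (r ^ w) := hro.pow
    omega
  -- `3` divides one of `A`, `A + 1 = r^w`, `A + 2`, so `q = 3` or `r = 3`
  have h3 : q = 3 ∨ r = 3 := by
    have h3r : 3 ∣ A + 1 → r = 3 := fun h3 =>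
      ((Nat.prime_dvd_prime_iff_eq Nat.prime_three hr).1
        (Nat.prime_three.dvd_of_dvd_pow (hA ▸ h3 : 3 ∣ r ^ w))).symm
    have h3q : 3 ∣ A * (A + 2) → q = 3 := fun h3 => by
      rw [hprod] at h3
      rcases (Nat.Prime.dvd_mul Nat.prime_three).1 h3 with h3 | h3
      · have := (Nat.prime_dvd_prime_iff_eq Nat.prime_three Nat.prime_two).1
          (Nat.prime_three.dvd_of_dvd_pow h3)
        omega
      · exact ((Nat.prime_dvd_prime_iff_eq Nat.prime_three hq).1
          (Nat.prime_three.dvd_of_dvd_pow h3)).symm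
    rcases (by omega : A % 3 = 0 ∨ A % 3 = 1 ∨ A % 3 = 2) with h | h | h
    · exact Or.inl (h3q ((Nat.dvd_of_mod_eq_zero h).mul_right _))
    · exact Or.inl (h3q (Dvd.dvd.mul_left (by omega : 3 ∣ A + 2) _))
    · exact Or.inr (h3r (by omega))
  -- the odd prime `q` divides at most one of `A`, `A + 2`
  have hnot : ¬(q ∣ A ∧ q ∣ A + 2) := fun ⟨h1, h2⟩ => by
    have := Nat.le_of_dvd two_pos ((Nat.dvd_add_right h1).1 h2)
    omega
  by_cases hqA2 : q ∣ A + 2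
  · -- (β) `q ∤ A`: `A + 2 = q^y k`, `k A = 2^x`, so `A = 2^s`, `k = 2^t`
    obtain ⟨k, hk, hk'⟩ :=
      shapeA_even_split hq (fun h' => hnot ⟨h', hqA2⟩) ((mul_comm _ _).trans hprod)
    obtain ⟨s, -, hs⟩ := (Nat.dvd_prime_pow Nat.prime_two).1 (Dvd.intro_left _ hk')
    obtain ⟨t, -, ht⟩ := (Nat.dvd_prime_pow Nat.prime_two).1 (Dvd.intro _ hk')
    have hs2 : 2 ≤ s := by
      by_contra hs2
      interval_cases s
      · omega
      · -- `A = 2`: `A + 2 = 4 = q^y k`, so `q ∣ 2`, excluded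
        rw [pow_one] at hs
        have hdvd : q ^ y ∣ A + 2 := Dvd.intro _ hk.symm
        rw [hs] at hdvd
        have h4 : q ∣ 2 ^ 2 := (dvd_pow_self q (by omega : y ≠ 0)).trans hdvd
        have := Nat.le_of_dvd two_pos (hq.dvd_of_dvd_pow h4)
        omega
    obtain ⟨u, rfl⟩ : ∃ u, s = u + 2 := ⟨s - 2, by omega⟩
    have h4 : 2 ^ (u + 2) = 4 * 2 ^ u := by ring
    -- `t = 1`: `A + 2 = 2^t q^y` is even but not divisible by `4`
    have ht1 : t = 1 := by
      rcases Nat.lt_trichotomy t 1 with ht0 | rfl | ht2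
      · obtain rfl : t = 0 := by omega
        rw [pow_zero] at ht
        rw [ht, mul_one] at hk
        obtain ⟨i, hi⟩ : Odd (A + 2) := by rw [hk]; exact hqo.pow
        omega
      · rfl
      · obtain ⟨v, rfl⟩ : ∃ v, t = v + 2 := ⟨t - 2, by omega⟩
        have : A + 2 = 4 * (2 ^ v * q ^ y) := by rw [hk, ht]; ring
        omega
    subst ht1
    rw [pow_one] at ht
    subst ht
    -- `2^(u+2) + 1 = r^w`: (B) gives `w ≤ 1` or `(r, w) = (3, 2)` (`c = 81`)
    rcases omegaTwo_two_pow_add_one_eq_pow hro hr3 (show 2 ^ (u + 2) + 1 = r ^ w by omega)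
      with hw1 | ⟨rfl, rfl⟩
    swap
    · decide
    obtain rfl : w = 1 := by omega
    rw [pow_one] at hA
    -- `2^(u+1) + 1 = q^y`: (B) gives `y ≤ 1` or `(q, y) = (3, 2)` (`A = 16`, `r = 17`, `c = 289`)
    have h2 : 2 ^ (u + 1) = 2 * 2 ^ u := by ring
    rcases omegaTwo_two_pow_add_one_eq_pow hqo hq3 (show 2 ^ (u + 1) + 1 = q ^ y by omega)
      with hy1 | ⟨rfl, rfl⟩
    · obtain rfl : y = 1 := le_antisymm hy1 hy
      rw [pow_one] at hk
      rcases h3 with rfl | rfl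
      · -- `q = 3`: `A = 4`, `r = 5`, `c = 25`
        obtain rfl : r = 5 := by omega
        decide
      · -- `r = 3`: `A = 2 = 4 · 2^u`, impossible
        exfalso
        omega
    · norm_num at hk
      obtain rfl : r = 17 := by omega
      decide
  · -- (α) `q^y ∣ A`: `A = q^y k`, `k (A + 2) = 2^x`, so `A + 2 = 2^s`, `k = 2^t`
    obtain ⟨k, hk, hk'⟩ := shapeA_even_split hq hqA2 hprod
    obtain ⟨s, -, hs⟩ := (Nat.dvd_prime_pow Nat.prime_two).1 (Dvd.intro_left _ hk')
    obtain ⟨t, -, ht⟩ := (Nat.dvd_prime_pow Nat.prime_two).1 (Dvd.intro _ hk')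
    have hs2 : 2 ≤ s := by
      by_contra hs2
      interval_cases s <;> omega
    obtain ⟨u, rfl⟩ : ∃ u, s = u + 2 := ⟨s - 2, by omega⟩
    have h4 : 2 ^ (u + 2) = 4 * 2 ^ u := by ring
    -- `t = 1`: `A = 2^t q^y` is even but not divisible by `4`
    have ht1 : t = 1 := by
      rcases Nat.lt_trichotomy t 1 with ht0 | rfl | ht2
      · obtain rfl : t = 0 := by omega
        rw [pow_zero] at ht
        rw [ht, mul_one] at hk
        obtain ⟨i, hi⟩ : Odd A := by rw [hk]; exact hqo.pow
        omega
      · rfl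
      · obtain ⟨v, rfl⟩ : ∃ v, t = v + 2 := ⟨t - 2, by omega⟩
        have : A = 4 * (2 ^ v * q ^ y) := by rw [hk, ht]; ring
        omega
    subst ht1
    rw [pow_one] at ht
    subst ht
    -- `r^w + 1 = 2^(u+2)`: (A) gives `w = 1`
    have hw1 : w ≤ 1 :=
      omegaTwo_pow_add_one_eq_two_pow hro hr3 (show r ^ w + 1 = 2 ^ (u + 2) by omega)
    obtain rfl : w = 1 := by omega
    rw [pow_one] at hA
    -- `q^y + 1 = 2^(u+1)`: (A) gives `y = 1`
    have h2 : 2 ^ (u + 1) = 2 * 2 ^ u := by ring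
    have hy1 : y ≤ 1 :=
      omegaTwo_pow_add_one_eq_two_pow hqo hq3 (show q ^ y + 1 = 2 ^ (u + 1) by omega)
    obtain rfl : y = 1 := le_antisymm hy1 hy
    rw [pow_one] at hk
    rcases h3 with rfl | rfl
    · -- `q = 3`: `A = 6`, `r = 7`, `c = 49`
      obtain rfl : r = 7 := by omega
      decide
    · -- `r = 3`: `A = 2 = 2q`, `q = 1`, impossible
      exfalso
      omega

/-! ## The classification -/

/-- **Shape A of the rung `W = 3`, even exponent: the complete list.** If `p, q, r` are primes,
`p ≠ q`, `x, y ≥ 1` and `1 + p^x q^y = r^(2w)`, then `r^(2w) ∈ {16, 25, 49, 64, 81, 289}`.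
For `r = 2`, `3 ∣ 4^w - 1` puts `3 ∈ {p, q}`; for `r` odd, `2 ∣ r^(2w) - 1` puts `2 ∈ {p, q}`; the
statement being symmetric in `(p, x) ↔ (q, y)`, the two normalised cases above conclude.
[folklore] -/
theorem shapeA_even_classification : ∀ p q r x y w : ℕ, p.Prime → q.Prime → r.Prime → p ≠ q →
    1 ≤ x → 1 ≤ y → 1 + p ^ x * q ^ y = r ^ (2 * w) →
    r ^ (2 * w) ∈ ({16, 25, 49, 64, 81, 289} : Finset ℕ) := by
  intro p q r x y w hp hq hr hpq hx hy h
  rcases hr.eq_two_or_odd' with rfl | hro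
  · -- `r = 2`: `3 ∣ p^x q^y = 4^w - 1`
    have h43 : 2 ^ (2 * w) % 3 = 1 := by
      rw [pow_mul, Nat.pow_mod]
      norm_num
    have h3 : 3 ∣ p ^ x * q ^ y := Nat.dvd_of_mod_eq_zero (by omega)
    rcases (Nat.Prime.dvd_mul Nat.prime_three).1 h3 with h3 | h3
    · obtain rfl : 3 = p :=
        (Nat.prime_dvd_prime_iff_eq Nat.prime_three hp).1 (Nat.prime_three.dvd_of_dvd_pow h3)
      exact shapeA_even_of_three hq hpq.symm hy h
    · obtain rfl : 3 = q :=
        (Nat.prime_dvd_prime_iff_eq Nat.prime_three hq).1 (Nat.prime_three.dvd_of_dvd_pow h3)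
      exact shapeA_even_of_three hp hpq hx (by rwa [mul_comm (p ^ x) (3 ^ y)] at h)
  · -- `r` odd: `2 ∣ p^x q^y = r^(2w) - 1`
    have h2 : 2 ∣ p ^ x * q ^ y := by
      obtain ⟨k, hk⟩ : Odd (r ^ (2 * w)) := hro.pow
      exact ⟨k, by omega⟩
    rcases (Nat.Prime.dvd_mul Nat.prime_two).1 h2 with h2 | h2
    · obtain rfl : 2 = p :=
        (Nat.prime_dvd_prime_iff_eq Nat.prime_two hp).1 (Nat.prime_two.dvd_of_dvd_pow h2)
      exact shapeA_even_of_two hq hr hpq.symm hro hy h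
    · obtain rfl : 2 = q :=
        (Nat.prime_dvd_prime_iff_eq Nat.prime_two hq).1 (Nat.prime_two.dvd_of_dvd_pow h2)
      exact shapeA_even_of_two hp hr hpq hro hx (by rwa [mul_comm (p ^ x) (2 ^ y)] at h)

end Summit.ABC.ABC.Theorems.UniformSadicTowerFour.BoundedOmega
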